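import Mathlib
import Summits.KontsevichZagierPeriods.Zeta5Search.Families.CellularIntegral
import Summits.KontsevichZagierPeriods.Zeta5Search.Families.CellularVanishingMiddle
import Summits.KontsevichZagierPeriods.Zeta5Search.Cells.VanishingMiddleLeading
import HarnessLib

/-!
# ζ(5) search — Families: bridge between `fam-brown9`'s VIM exponent data and Brown's valuation calculus

HONEST FRAMING: systematic search; no irrationality claim unless certified.

Cell `pub-zeta5`, seat P2.  `Cells/VanishingMiddleLeading.lean` (family designer `fam-brown9`) records, for the
configuration `σ = (10,2,4,1,6,3,8,5,9,7)` with exponents `a, b : Fin 10 → ℕ` (same indexing conventions as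
`Families/CellularIntegral.lean`: `a i` on the `δ⁰`-side `{i+1,i+2}`, `b j` on the `σ`-side `{σ_{j+1}, σ_{j+2}}`), the
hand-derived predicates `Balanced a b` (ten vertex balances) and `Admissible a b` (sixteen block inequalities, FAMILY.md
§1).  This file CERTIFIES them against the configuration-generic definitions:

* `balanced_iff_homogeneous` : `Balanced a b ↔ Homogeneous vim10 (↑a) (↑b)` [Brown2016, §5.1 (5.2)];
* `admissible_iff_brownConvergent` : under `Balanced a b`,
  `Admissible a b ↔ BrownConvergent vim10 (↑a) (↑b)` — i.e. the sixteen inequalities ARE Brown's chord-by-chord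
  convergence condition [Brown2016, §2.4 (2.3), §3.4, Lemma 3.11] (all `10 × 7` valuations), for every `a, b ∈ ℕ¹⁰`
  on the balance lattice (kernel-checked, `omega`).
Consequently the basic members are Brown-convergent (`brownConvergent_vim_basic`, also directly in
`Families/CellularVanishingMiddle.lean`).
-/

namespace Summit.KontsevichZagierPeriods.Zeta5Search.Families.Cellular

open Summit.KontsevichZagierPeriods.Zeta5Search.Cells

/-- `fam-brown9`'s ten vertex balances are exactly Brown's homogeneity equations for `vim10`. [Brown2016, §5.1 (5.2)] -/
theorem balanced_iff_homogeneous (a b : Fin 10 → ℕ) :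
    VanishingMiddleLeading.Balanced a b ↔ Homogeneous vim10 (fun i => (a i : ℤ)) (fun j => (b j : ℤ)) := by
  unfold VanishingMiddleLeading.Balanced Homogeneous
  dsimp only [Nat.reduceAdd]
  have e : (-1 : Fin 10) = 9 := by decide
  simp only [forall_fin10]
  simp [vim10, e]
  omega

/-- `fam-brown9`'s sixteen block inequalities are exactly Brown's convergence condition for the generalised
`(10,2,4,1,6,3,8,5,9,7)` family, for all `ℕ`-valued exponents on the balance lattice. [Brown2016, §2.4 (2.3), §3.4, §5.2] -/
theorem admissible_iff_brownConvergent (a b : Fin 10 → ℕ) (hB : VanishingMiddleLeading.Balanced a b) :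
    VanishingMiddleLeading.Admissible a b ↔ BrownConvergent vim10 (fun i => (a i : ℤ)) (fun j => (b j : ℤ)) := by
  unfold VanishingMiddleLeading.Balanced at hB
  unfold VanishingMiddleLeading.Admissible BrownConvergent twoOrd
  dsimp only [Nat.reduceAdd]
  simp only [forall_fin10, forall_fin7, sum_fin10]
  simp [sameSide, vim10]
  omega

/-- The basic members `a = b = (n,…,n)` satisfy Brown's convergence condition (via the bridge and
`VanishingMiddleLeading.admissible_basic`). -/
theorem brownConvergent_vim_basic (n : ℕ) :
    BrownConvergent vim10 (fun _ => (n : ℤ)) (fun _ => (n : ℤ)) :=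
  (admissible_iff_brownConvergent _ _ (VanishingMiddleLeading.balanced_basic n)).1
    (VanishingMiddleLeading.admissible_basic n)

end Summit.KontsevichZagierPeriods.Zeta5Search.Families.Cellular
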